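import Mathlib
import Literature.MathematicalPhysics.QuantumFieldTheory.BalabanImbrieJaffe1984to88.BIJ88PkDerivatives
import Literature.MathematicalPhysics.QuantumFieldTheory.BalabanImbrieJaffe1984to88.BIJ88Sect5StatementsPart3

/-!
# `BalabanImbrieJaffe1984to88.BIJ88Claim279PkLower` — T. Bałaban, J. Imbrie, A. Jaffe, *Effective action and cluster
properties of the abelian Higgs model*, Commun. Math. Phys. **114** (1988) 257–315 [BalabanImbrieJaffe1988]: Sect. 5.2
"Restrictions on the Fields", the claim of p. 279 — on the support of the large-field function `χ^c_x` the dominant term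
is bounded below, `P_k(φ(x)) ≥ O(p(e_k)²)` — PROVED with explicit constants

statement-level skeleton of published theorems with citation tags; proofs where landed; nothing here is a
claim about the Yang–Mills mass gap

PDF held: `paper:balaban1988-cmp114-bij-abelian-higgs-effective-action` (journal page = PDF page + 256); p. 279 [PDF 23] read on
the ×2 render `HOME/lit-balaban-p27/renders/original-p023-x2.png` (pure-python CCITT-G4 renderer `g4png.py`).

CITATION HEADER (lean-in-tree rule).  lit-balaban TYPED SKELETON, PHASE 2 (HOME `run/shared/lean/pub/lit-balaban/`); proof
seat p27, generation 3 (unit `lit-balaban-p27`; TAKING line HOME/STATUS.md 2026-08-21T03:44:43Z); row owner `lit-balaban-r16`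
(row **C2.Eq5.2.5**, whose informal statement carries this sentence; the row's identity (5.2.5) is r16's `eq525`/`Pk_eq_sq`);
referee group ref-5.  THE PRINTED TEXT (p. 279, verbatim): *"For (L^kε)^d < λ, the quartic term gets larger before the
quadratic term, whereas for (L^kε)^d > λ, the quadratic term gets large first. It is easy to see that for |φ(x)| in the
support of χ^c_x, P_k(φ(x)) ≧ O(p(e_k)²)."*  Here `χ_x = 1 − χ^c_x` is (5.2.2) p. 278 — r16's
`BIJ88Sect5StatementsPart3.chiX χ lamk p(e_k) s λ d (φ x)`: `χ(lamk·p(e_k), |φ(x)|)` if `(L^kε)^d < λ`,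
`χ((L^kε)⁻¹p(e_k), ||φ(x)| − (8λ)^{−1/2}(L^kε)^{(d−2)/2}|)` if `(L^kε)^d ≧ λ`, with the cutoff `χ(p, x) = χ(1, x/p)`,
`χ(1, x) = 1` for `|x| ≤ 9/10` ((5.2.3)–(5.2.4), `CutoffProfile`, `cutoff`, `cutoff_eq_one`).  The first radius is printed
`λ_kp(e_k)`; the restriction it enforces is `|φ| ≦ cλ_k^{−1/4}p(e_k)` ((4.5) p. 274, (5.9.2) p. 296 — r16's transcription note T10,
`lamk` left free in `chiX`); the claim is proved here for `lamk = c·λ_k^{−1/4}` (main statement: `c = 1`).  With the printed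
radius `λ_kp(e_k)` the claim FAILS (kernel witness `claim279_asPrinted_witness`: d = 3, λ = 1, L^kε = 1/100, p(e_k) = 1,
|φ(x)| = ρ₀ gives χ_x = 0 — the value is in the support of χ^c_x for every profile χ — and P_k(φ(x)) = 0; recorded for the
T10 adjudication, not a re-reading of the row).

THE PROOF (ours — "it is easy to see").  `P_k(φ) = λ_k(|φ|² − ρ₀²)²`, `λ_kρ₀² = s²/8`, `s = L^kε` (`BIJ88Sect5Statements.Pk_eq_sq`,
`lamK_mul_rho0_sq`; `BIJ88PkDerivatives.Pk_eq_quartic`).  (i) Ring regime (`(L^kε)^d ≧ λ`): on `supp χ^c_x`,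
`||φ| − ρ₀| > (9/10)s⁻¹p(e_k)`, and `(|φ|² − ρ₀²)² = (|φ| − ρ₀)²(|φ| + ρ₀)² ≥ (|φ| − ρ₀)²ρ₀²`, so
`P_k ≥ λ_kρ₀²·(81/100)s⁻²p² = (81/800)p(e_k)²` — this holds for EVERY `λ_k` (`Pk_ge_of_ring_dist`).  (ii) Quartic regime
(`(L^kε)^d < λ`, i.e. `s⁴ < λ_k`): on `supp χ^c_x`, `|φ| > (9/10)cλ_k^{−1/4}p`, while `ρ₀² = s²/(8λ_k) < λ_k^{−1/2}/8`; hence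
`|φ|² − ρ₀² ≥ ((81/100)c² − 1/8)p²λ_k^{−1/2}` (`p ≥ 1`, `c ≥ 1/2`) and `P_k ≥ ((81/100)c² − 1/8)²p(e_k)⁴` (`Pk_ge_of_norm_ge`).
(iii) `Pk_ge_on_support` — for `c = 1`: `χ_x(φ(x)) ≠ 1 ⇒ P_k(φ(x)) ≥ (81/800)p(e_k)²` in both regimes (`(137/200)²p⁴ ≥ (81/800)p²`);
`exp_neg_Pk_le_on_support` (the small factor `e^{−P_k} ≤ e^{−(81/800)p²}`); (iv) the p. 278 mechanism *"small factors
exp(−cp(e_k)²) ≦ e_k^κ, for any κ"* PROVED for the logarithmic scale `p(e_k) = |log e_k⁻¹|^p`, `p > 1/2` ((2.33), r18's `pLog`):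
`exp_neg_mul_pLog_sq_le_rpow` (for `e_k ≤ exp(−(κ/c)^{1/(2p−1)})`), `exp_neg_Pk_le_rpow_on_support`; (v) the other three species
of p. 278 (`χ^c_y`, `χ^c_b`, `χ^c_p`, r16's `chiY`/`chiB`/`chiP`): `normSq_ge_on_support_chiY`/`_chiB` (`|·|² ≥ (81/100)p(e_k)²`) and
`wilson_ge_on_support_chiP` (`e_k⁻²(1 − Re u(p)) ≥ (81/200)p(e_k)²` for `|u(p)| = 1`, via `1 − Re u = ½|u − 1|²`);
`claim279_asPrinted_witness` (see above).
Theorems only; no `def`; no `sorry`; axioms ⊆ {propext, Classical.choice, Quot.sound}.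
-/

namespace Literature.MathematicalPhysics.QuantumFieldTheory.BalabanImbrieJaffe1984to88.BIJ88Claim279PkLower

open BIJ88Sect5Statements (lamK rho0 lamK_mul_rho0_sq rho0_sq CutoffProfile cutoff cutoff_eq_one cutoff_eq_zero)
open BIJ88Sect5StatementsPart3 (chiX)
open BIJ88PkDerivatives

noncomputable section

variable {lam s : ℝ}

/-- kernel: the pointwise completed square `P_k(φ) = λ_k(|φ|² − ρ₀²)²`. [cite: BalabanImbrieJaffe1988, (5.2.5) p.278] -/
theorem Pk_apply_eq (hlam : 0 < lam) (hs : 0 < s) (d : ℕ) (z : ℂ) :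
    BIJ88Sect4Statements.Pk (lamK lam s d) s lam d z = lamK lam s d * (‖z‖ ^ 2 - rho0 lam s d ^ 2) ^ 2 := by
  rw [congrFun (Pk_eq_quartic hlam hs d) z]
  ring

/-- **p. 279, ring regime** (`(L^kε)^d ≧ λ`: *"the quadratic term gets large first"*): if `||φ| − ρ₀| ≥ (9/10)·cs⁻¹p` then
`P_k(φ) ≥ (81/800)c²p²` — from `(|φ|² − ρ₀²)² = (|φ| − ρ₀)²(|φ| + ρ₀)² ≥ (|φ| − ρ₀)²ρ₀²` and `λ_kρ₀² = s²/8`; valid for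
every value of `λ_k`. [cite: BalabanImbrieJaffe1988, (5.2.5) p.279] -/
theorem Pk_ge_of_ring_dist (hlam : 0 < lam) (hs : 0 < s) (d : ℕ) {c pek : ℝ} (hc : 0 ≤ c) (hp : 0 ≤ pek) (z : ℂ)
    (hz : 9 / 10 * (c * s⁻¹ * pek) ≤ |‖z‖ - rho0 lam s d|) :
    81 / 800 * c ^ 2 * pek ^ 2 ≤ BIJ88Sect4Statements.Pk (lamK lam s d) s lam d z := by
  set Λ := lamK lam s d with hΛdef
  set ρ := rho0 lam s d with hρdef
  have hΛ : 0 < Λ := lamK_pos hlam hs d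
  have hρ : 0 ≤ ρ := Real.sqrt_nonneg _
  have hkey : Λ * ρ ^ 2 = s ^ 2 / 8 := lamK_mul_rho0_sq hlam hs d
  have hz0 : 0 ≤ ‖z‖ := norm_nonneg z
  have ht : 0 ≤ 9 / 10 * (c * s⁻¹ * pek) := by positivity
  have h1 : (9 / 10 * (c * s⁻¹ * pek)) ^ 2 ≤ (‖z‖ - ρ) ^ 2 := by
    rw [← sq_abs (‖z‖ - ρ)]
    exact pow_le_pow_left₀ ht hz 2
  have h2 : ρ ^ 2 ≤ (‖z‖ + ρ) ^ 2 := pow_le_pow_left₀ hρ (by linarith) 2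
  rw [Pk_apply_eq hlam hs d z]
  calc 81 / 800 * c ^ 2 * pek ^ 2 = s ^ 2 / 8 * (9 / 10 * (c * s⁻¹ * pek)) ^ 2 := by field_simp; ring
    _ = Λ * ((9 / 10 * (c * s⁻¹ * pek)) ^ 2 * ρ ^ 2) := by rw [← hkey]; ring
    _ ≤ Λ * ((‖z‖ - ρ) ^ 2 * (‖z‖ + ρ) ^ 2) := by gcongr
    _ = Λ * (‖z‖ ^ 2 - ρ ^ 2) ^ 2 := by ring

/-- **p. 279, quartic regime** (`(L^kε)^d < λ`: *"the quartic term gets larger before the quadratic term"*): if `s^d < λ`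
(equivalently `s⁴ < λ_k`) and `|φ| ≥ (9/10)·cλ_k^{−1/4}p` with `c ≥ 1/2`, `p ≥ 1`, then `P_k(φ) ≥ ((81/100)c² − 1/8)²p⁴` — from
`ρ₀² = s²/(8λ_k) < λ_k^{−1/2}/8`. [cite: BalabanImbrieJaffe1988, (5.2.5) p.279] -/
theorem Pk_ge_of_norm_ge (hlam : 0 < lam) (hs : 0 < s) (d : ℕ) (hsd : s ^ d < lam) {c pek : ℝ} (hc : 1 / 2 ≤ c)
    (hp : 1 ≤ pek) (z : ℂ) (hz : 9 / 10 * (c * (lamK lam s d) ^ (-(1 / 4 : ℝ)) * pek) ≤ ‖z‖) :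
    (81 / 100 * c ^ 2 - 1 / 8) ^ 2 * pek ^ 4 ≤ BIJ88Sect4Statements.Pk (lamK lam s d) s lam d z := by
  have hΛ : 0 < lamK lam s d := lamK_pos hlam hs d
  have hkey : lamK lam s d * rho0 lam s d ^ 2 = s ^ 2 / 8 := lamK_mul_rho0_sq hlam hs d
  -- the fourth root u = λ_k^{1/4}: u > 0, u⁴ = λ_k, λ_k^{−1/4} = u⁻¹
  have hu : 0 < lamK lam s d ^ (1 / 4 : ℝ) := Real.rpow_pos_of_pos hΛ _
  have hu4 : (lamK lam s d ^ (1 / 4 : ℝ)) ^ 4 = lamK lam s d := by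
    rw [← Real.rpow_natCast (lamK lam s d ^ (1 / 4 : ℝ)) 4, ← Real.rpow_mul hΛ.le]; norm_num
  rw [Real.rpow_neg hΛ.le] at hz
  set u := lamK lam s d ^ (1 / 4 : ℝ) with hudef
  set ρ := rho0 lam s d with hρdef
  -- s < u, from s⁴ < λ_k = u⁴
  have hs4 : s ^ 4 < lamK lam s d := by
    rw [← not_le, ← le_pow_iff_lamK_le_pow_four hs lam d, not_le]; exact hsd
  have hsu : s < u := lt_of_pow_lt_pow_left₀ 4 hu.le (by rw [hu4]; exact hs4)
  -- ρ² u² < 1/8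
  have hρu : ρ ^ 2 * u ^ 2 < 1 / 8 := by
    have h : ρ ^ 2 * u ^ 2 * u ^ 2 < 1 / 8 * u ^ 2 := by
      calc ρ ^ 2 * u ^ 2 * u ^ 2 = lamK lam s d * ρ ^ 2 := by rw [← hu4]; ring
        _ = s ^ 2 / 8 := hkey
        _ < u ^ 2 / 8 := by gcongr
        _ = 1 / 8 * u ^ 2 := by ring
    exact lt_of_mul_lt_mul_right h (by positivity)
  -- |z| u ≥ (9/10) c p
  have hA : 9 / 10 * c * pek ≤ ‖z‖ * u := by
    calc 9 / 10 * c * pek = 9 / 10 * (c * u⁻¹ * pek) * u := by field_simp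
      _ ≤ ‖z‖ * u := mul_le_mul_of_nonneg_right hz hu.le
  have hc0 : 0 ≤ c := le_trans (by norm_num) hc
  have hp0 : 0 ≤ pek := zero_le_one.trans hp
  have hA2 : (9 / 10 * c * pek) ^ 2 ≤ (‖z‖ * u) ^ 2 := pow_le_pow_left₀ (by positivity) hA 2
  have hp2 : 1 ≤ pek ^ 2 := one_le_pow₀ hp
  have hK : 0 ≤ 81 / 100 * c ^ 2 - 1 / 8 := by nlinarith
  -- (|z|² − ρ²) u² ≥ ((81/100)c² − 1/8) p²
  have hmain : (81 / 100 * c ^ 2 - 1 / 8) * pek ^ 2 ≤ (‖z‖ ^ 2 - ρ ^ 2) * u ^ 2 := by nlinarith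
  have hmain' := pow_le_pow_left₀ (by positivity) hmain 2
  rw [Pk_apply_eq hlam hs d z]
  calc (81 / 100 * c ^ 2 - 1 / 8) ^ 2 * pek ^ 4 = ((81 / 100 * c ^ 2 - 1 / 8) * pek ^ 2) ^ 2 := by ring
    _ ≤ ((‖z‖ ^ 2 - ρ ^ 2) * u ^ 2) ^ 2 := hmain'
    _ = lamK lam s d * (‖z‖ ^ 2 - ρ ^ 2) ^ 2 := by rw [← hu4]; ring

/-- **p. 279, the claim** — *"It is easy to see that for |φ(x)| in the support of χ^c_x, P_k(φ(x)) ≧ O(p(e_k)²)"* — PROVED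
with the explicit constant `81/800`: for `λ > 0`, `s = L^kε > 0`, `p(e_k) ≥ 1`, any cutoff profile `χ` of (5.2.3), any `d`, and
`χ_x` = r16's `chiX` ((5.2.2)) with first radius `λ_k^{−1/4}p(e_k)` (the (4.5) reading, `c = 1`), if `χ_x(φ(x)) ≠ 1` — i.e.
`χ^c_x(φ(x)) = 1 − χ_x(φ(x)) ≠ 0`, `φ(x)` in the support of `χ^c_x` — then `P_k(φ(x)) ≥ (81/800)·p(e_k)²`.
[cite: BalabanImbrieJaffe1988, (5.2.5) p.279] -/
theorem Pk_ge_on_support (χ : CutoffProfile) (hlam : 0 < lam) (hs : 0 < s) (d : ℕ) {pek : ℝ} (hp : 1 ≤ pek) (z : ℂ)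
    (h : chiX χ ((lamK lam s d) ^ (-(1 / 4 : ℝ))) pek s lam d z ≠ 1) :
    81 / 800 * pek ^ 2 ≤ BIJ88Sect4Statements.Pk (lamK lam s d) s lam d z := by
  have hΛ : 0 < lamK lam s d := lamK_pos hlam hs d
  have hp0 : 0 < pek := zero_lt_one.trans_le hp
  unfold chiX at h
  split_ifs at h with hsd
  · -- quartic regime: |φ(x)| > (9/10) λ_k^{−1/4} p(e_k)
    have hr : 0 < lamK lam s d ^ (-(1 / 4 : ℝ)) * pek := mul_pos (Real.rpow_pos_of_pos hΛ _) hp0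
    have hlt : 9 / 10 * (lamK lam s d ^ (-(1 / 4 : ℝ)) * pek) < ‖z‖ := by
      by_contra hle
      exact h (cutoff_eq_one χ hr (by rw [abs_of_nonneg (norm_nonneg z)]; exact not_lt.mp hle))
    have hz : 9 / 10 * (1 * lamK lam s d ^ (-(1 / 4 : ℝ)) * pek) ≤ ‖z‖ := by rw [one_mul]; exact hlt.le
    have hq := Pk_ge_of_norm_ge hlam hs d hsd (by norm_num : (1 / 2 : ℝ) ≤ 1) hp z hz
    have hp2 : pek ^ 2 ≤ pek ^ 4 := by nlinarith [one_le_pow₀ (n := 2) hp]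
    nlinarith [hq, hp2]
  · -- ring regime: ||φ(x)| − ρ₀| > (9/10) s⁻¹ p(e_k)
    rw [ringRadius_eq_rho0 hlam hs] at h
    have hr : 0 < s⁻¹ * pek := mul_pos (inv_pos.mpr hs) hp0
    have hlt : 9 / 10 * (s⁻¹ * pek) < |‖z‖ - rho0 lam s d| := by
      by_contra hle
      exact h (cutoff_eq_one χ hr (not_lt.mp hle))
    have hz : 9 / 10 * (1 * s⁻¹ * pek) ≤ |‖z‖ - rho0 lam s d| := by rw [one_mul]; exact hlt.le
    have hq := Pk_ge_of_ring_dist hlam hs d zero_le_one hp0.le z hz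
    simpa using hq

/-- p. 279 with `χ^c_x` written out: `χ^c_x(φ(x)) := 1 − χ_x(φ(x)) ≠ 0 ⇒ P_k(φ(x)) ≥ (81/800)p(e_k)²`.
[cite: BalabanImbrieJaffe1988, (5.2.5) p.279] -/
theorem Pk_ge_of_chiXc_ne_zero (χ : CutoffProfile) (hlam : 0 < lam) (hs : 0 < s) (d : ℕ) {pek : ℝ} (hp : 1 ≤ pek)
    (z : ℂ) (h : 1 - chiX χ ((lamK lam s d) ^ (-(1 / 4 : ℝ))) pek s lam d z ≠ 0) :
    81 / 800 * pek ^ 2 ≤ BIJ88Sect4Statements.Pk (lamK lam s d) s lam d z :=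
  Pk_ge_on_support χ hlam hs d hp z fun h1 => h (by rw [h1, sub_self])

/-- p. 278 [PDF 22], the purpose of the `χ^c` factors, verbatim: *"At each x, y, b, or p where a χ^c factor is present, we
expect to obtain small factors exp(−cp(e_k)²) ≦ e_k^κ, for any κ, using the positivity of terms in the action."* — for the
site factors this is the p. 279 claim exponentiated: on the support of `χ^c_x`, `exp(−P_k(φ(x))) ≤ exp(−(81/800)p(e_k)²)`.
[cite: BalabanImbrieJaffe1988, (5.2.5) p.279] -/
theorem exp_neg_Pk_le_on_support (χ : CutoffProfile) (hlam : 0 < lam) (hs : 0 < s) (d : ℕ) {pek : ℝ} (hp : 1 ≤ pek)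
    (z : ℂ) (h : chiX χ ((lamK lam s d) ^ (-(1 / 4 : ℝ))) pek s lam d z ≠ 1) :
    Real.exp (-BIJ88Sect4Statements.Pk (lamK lam s d) s lam d z) ≤ Real.exp (-(81 / 800 * pek ^ 2)) :=
  Real.exp_le_exp.mpr (neg_le_neg (Pk_ge_on_support χ hlam hs d hp z h))

/-! ## p. 278: the other three species — `χ^c_y`, `χ^c_b`, `χ^c_p` — and "the positivity of terms in the action" -/

/-- p. 278, block-site factors: on the support of `χ^c_y` (`χ_y = χ(p(e_k), |(ψ − Q(u_k)φ)(y)|)`, r16's `chiY`), the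
fluctuation term of the action obeys `|(ψ − Q(u_k)φ)(y)|² ≥ (81/100)p(e_k)²` (so `½aL⁻²|ψ − Q(u_k)φ|²(y) ≥ (81/200)aL⁻²p(e_k)²`).
[cite: BalabanImbrieJaffe1988, (5.2.2) p.278] -/
theorem normSq_ge_on_support_chiY (χ : CutoffProfile) {pek : ℝ} (hp : 0 < pek) (ψy Qφy : ℂ)
    (h : BIJ88Sect5StatementsPart3.chiY χ pek ψy Qφy ≠ 1) : 81 / 100 * pek ^ 2 ≤ ‖ψy - Qφy‖ ^ 2 := by
  have hlt : 9 / 10 * pek < ‖ψy - Qφy‖ := by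
    by_contra hle
    exact h (cutoff_eq_one χ hp (by rw [abs_of_nonneg (norm_nonneg _)]; exact not_lt.mp hle))
  nlinarith [hlt, norm_nonneg (ψy - Qφy)]

/-- p. 278, bond factors: on the support of `χ^c_b` (`χ_b = χ(p(e_k), |(D_{ū_k}φ)(b)|)`, r16's `chiB`), the covariant
kinetic term obeys `|(D_{ū_k}φ)(b)|² ≥ (81/100)p(e_k)²`. [cite: BalabanImbrieJaffe1988, (5.2.2) p.278] -/
theorem normSq_ge_on_support_chiB {P : Balaban1983to89.Params} {j : ℕ} (χ : CutoffProfile) {pek : ℝ} (hp : 0 < pek)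
    (ubar : Balaban1983to89.PBond P j → ℂ) (φ : Balaban1983to89.Site P j → ℂ) (b : Balaban1983to89.PBond P j)
    (h : BIJ88Sect5StatementsPart3.chiB χ pek ubar φ b ≠ 1) :
    81 / 100 * pek ^ 2 ≤ ‖BIJ88Sect3Statements.covD 1 ubar φ b‖ ^ 2 := by
  have hlt : 9 / 10 * pek < ‖BIJ88Sect3Statements.covD 1 ubar φ b‖ := by
    by_contra hle
    exact h (cutoff_eq_one χ hp (by rw [abs_of_nonneg (norm_nonneg _)]; exact not_lt.mp hle))
  nlinarith [hlt, norm_nonneg (BIJ88Sect3Statements.covD 1 ubar φ b)]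

/-- kernel: for a unit-modulus plaquette variable, the Wilson term is a square — `1 − Re u = ½|u − 1|²` (`|u| = 1`). [folklore] -/
private theorem one_sub_re_eq_half_normSq {u : ℂ} (hu : ‖u‖ = 1) : 1 - u.re = 1 / 2 * ‖u - 1‖ ^ 2 := by
  have h1 : ‖u‖ ^ 2 = u.re ^ 2 + u.im ^ 2 := by
    rw [Complex.sq_norm, Complex.normSq_apply]; ring
  have h2 : ‖u - 1‖ ^ 2 = (u.re - 1) ^ 2 + u.im ^ 2 := by
    rw [Complex.sq_norm, Complex.normSq_apply]; simp; ring
  rw [hu, one_pow] at h1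
  rw [h2]; nlinarith [h1]

/-- p. 278, plaquette factors: on the support of `χ^c_p` (`χ_p = χ(e_kp(e_k), |u(p) − 1|)`, r16's `chiP`), the Wilson term of the
action ((3.3): `e_k⁻²[1 − Re u(p)]`, `|u(p)| = 1`) obeys `e_k⁻²(1 − Re u(p)) ≥ (81/200)p(e_k)²` — "the positivity of terms in the
action": `1 − Re u = ½|u − 1|²`. [cite: BalabanImbrieJaffe1988, (5.2.2) p.278] -/
theorem wilson_ge_on_support_chiP (χ : CutoffProfile) {ek pek : ℝ} (hek : 0 < ek) (hp : 0 < pek) {up : ℂ} (hu : ‖up‖ = 1)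
    (h : BIJ88Sect5StatementsPart3.chiP χ ek pek up ≠ 1) : 81 / 200 * pek ^ 2 ≤ ek⁻¹ ^ 2 * (1 - up.re) := by
  have hlt : 9 / 10 * (ek * pek) < ‖up - 1‖ := by
    by_contra hle
    exact h (cutoff_eq_one χ (mul_pos hek hp) (by rw [abs_of_nonneg (norm_nonneg _)]; exact not_lt.mp hle))
  have hsq : (9 / 10 * (ek * pek)) ^ 2 ≤ ‖up - 1‖ ^ 2 := pow_le_pow_left₀ (by positivity) hlt.le 2
  rw [one_sub_re_eq_half_normSq hu]
  have hek2 : 0 < ek ^ 2 := by positivity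
  calc 81 / 200 * pek ^ 2 = ek⁻¹ ^ 2 * (1 / 2 * (9 / 10 * (ek * pek)) ^ 2) := by field_simp; ring
    _ ≤ ek⁻¹ ^ 2 * (1 / 2 * ‖up - 1‖ ^ 2) := by gcongr

/-! ## p. 278: the small factors `exp(−cp(e_k)²) ≦ e_k^κ, for any κ` -/

/-- p. 278 [PDF 22], verbatim: *"At each x, y, b, or p where a χ^c factor is present, we expect to obtain small factors
exp(−cp(e_k)²) ≦ e_k^κ, for any κ, using the positivity of terms in the action."* — the MECHANISM, PROVED: with the logarithmic
scale `p(e_k) = |log e_k⁻¹|^p` ((2.33), r18's `BIJ88Sect2Statements.pLog`) and `p > 1/2`, for every `c > 0` and `κ ≥ 0` one has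
`exp(−c·p(e_k)²) ≤ e_k^κ` as soon as `e_k ≤ exp(−(κ/c)^{1/(2p−1)})` (i.e. `c|log e_k|^{2p−1} ≥ κ`). [cite: BalabanImbrieJaffe1988, (5.2.2) p.278] -/
theorem exp_neg_mul_pLog_sq_le_rpow {c κ p ek : ℝ} (hc : 0 < c) (hκ : 0 ≤ κ) (hp : 1 / 2 < p) (hek : 0 < ek)
    (hsmall : ek ≤ Real.exp (-((κ / c) ^ (1 / (2 * p - 1))))) :
    Real.exp (-(c * BIJ88Sect2Statements.pLog p ek ^ 2)) ≤ ek ^ κ := by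
  -- t = log e_k⁻¹ ≥ t₀ = (κ/c)^{1/(2p−1)} ≥ 0
  set t := Real.log ek⁻¹ with ht
  have hq : 0 < 2 * p - 1 := by linarith
  have ht0 : 0 ≤ (κ / c) ^ (1 / (2 * p - 1)) := Real.rpow_nonneg (div_nonneg hκ hc.le) _
  have htge : (κ / c) ^ (1 / (2 * p - 1)) ≤ t := by
    have h1 : Real.log ek ≤ -((κ / c) ^ (1 / (2 * p - 1))) := by
      rw [← Real.log_exp (-((κ / c) ^ (1 / (2 * p - 1))))]
      exact Real.log_le_log hek hsmall
    rw [ht, Real.log_inv]; linarith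
  have htnn : 0 ≤ t := ht0.trans htge
  have hpLog : BIJ88Sect2Statements.pLog p ek = t ^ p := by
    rw [BIJ88Sect2Statements.pLog, abs_of_nonneg htnn]
  -- κ t ≤ c t^{2p}
  have hpow : κ / c ≤ t ^ (2 * p - 1) := by
    calc κ / c = ((κ / c) ^ (1 / (2 * p - 1))) ^ (2 * p - 1) := by
          rw [← Real.rpow_mul (div_nonneg hκ hc.le), one_div_mul_cancel hq.ne', Real.rpow_one]
      _ ≤ t ^ (2 * p - 1) := Real.rpow_le_rpow ht0 htge hq.le
  have hkey : κ * t ≤ c * (t ^ p) ^ 2 := by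
    have h2p : (t ^ p) ^ 2 = t ^ (2 * p - 1) * t := by
      rcases htnn.eq_or_lt with h0 | hpos
      · rw [← h0, Real.zero_rpow (by linarith : p ≠ 0)]; ring
      · rw [← Real.rpow_natCast (t ^ p) 2, ← Real.rpow_mul htnn, show p * ((2 : ℕ) : ℝ) = (2 * p - 1) + 1 by push_cast; ring,
          Real.rpow_add hpos, Real.rpow_one]
    rw [h2p]
    have : κ ≤ c * t ^ (2 * p - 1) := by
      have := mul_le_mul_of_nonneg_left hpow hc.le
      rwa [mul_div_cancel₀ _ hc.ne'] at this
    calc κ * t ≤ (c * t ^ (2 * p - 1)) * t := mul_le_mul_of_nonneg_right this htnn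
      _ = c * (t ^ (2 * p - 1) * t) := by ring
  -- exp(−c p²) ≤ exp(−κ t) = e_k^κ
  rw [hpLog, Real.rpow_def_of_pos hek, show Real.log ek * κ = -(κ * t) by rw [ht, Real.log_inv]; ring]
  exact Real.exp_le_exp.mpr (by linarith)

/-- p. 278/p. 279 combined for the site factors: on the support of `χ^c_x` (radius `λ_k^{−1/4}p(e_k)`, `c = 1`),
`exp(−P_k(φ(x))) ≤ e_k^κ` for every `κ ≥ 0`, once `e_k ≤ exp(−(800κ/81)^{1/(2p−1)})` (`p(e_k) = |log e_k⁻¹|^p`, `p > 1/2`).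
[cite: BalabanImbrieJaffe1988, (5.2.5) p.279] -/
theorem exp_neg_Pk_le_rpow_on_support (χ : CutoffProfile) (hlam : 0 < lam) (hs : 0 < s) (d : ℕ) {p ek κ : ℝ}
    (hp : 1 / 2 < p) (hek : 0 < ek) (hκ : 0 ≤ κ) (hpek : 1 ≤ BIJ88Sect2Statements.pLog p ek)
    (hsmall : ek ≤ Real.exp (-((κ / (81 / 800)) ^ (1 / (2 * p - 1))))) (z : ℂ)
    (h : chiX χ ((lamK lam s d) ^ (-(1 / 4 : ℝ))) (BIJ88Sect2Statements.pLog p ek) s lam d z ≠ 1) :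
    Real.exp (-BIJ88Sect4Statements.Pk (lamK lam s d) s lam d z) ≤ ek ^ κ :=
  (exp_neg_Pk_le_on_support χ hlam hs d hpek z h).trans
    (exp_neg_mul_pLog_sq_le_rpow (by norm_num) hκ hp hek hsmall)

/-- AS PRINTED — with the first radius of (5.2.2) read literally as `λ_kp(e_k)` — the p. 279 claim has a counterexample for
EVERY cutoff profile `χ` of (5.2.3): at `d = 3`, `λ = 1`, `L^kε = 1/100` (so `(L^kε)^d < λ`, `λ_k = 1/100`, `ρ₀² = 1/800`),
`p(e_k) = 1` and `|φ(x)| = ρ₀ ≥ λ_kp(e_k)`, one has `χ_x(φ(x)) = χ(λ_kp(e_k), ρ₀) = 0` (the value lies in the support of `χ^c_x`,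
indeed `χ^c_x = 1`) while `P_k(φ(x)) = λ_k(ρ₀² − ρ₀²)² = 0`.  Kernel witness for the transcription note T10 (the intended radius
is `cλ_k^{−1/4}p(e_k)`, for which `Pk_ge_on_support` holds). [cite: BalabanImbrieJaffe1988, (5.2.5) p.279] -/
theorem claim279_asPrinted_witness (χ : CutoffProfile) :
    chiX χ (lamK 1 (1 / 100) 3) 1 (1 / 100) 1 3 ((rho0 1 (1 / 100) 3 : ℝ) : ℂ) = 0 ∧
      BIJ88Sect4Statements.Pk (lamK 1 (1 / 100) 3) (1 / 100) 1 3 ((rho0 1 (1 / 100) 3 : ℝ) : ℂ) = 0 := by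
  have hlam : (0 : ℝ) < 1 := one_pos
  have hs : (0 : ℝ) < 1 / 100 := by norm_num
  have hρ0 : 0 ≤ rho0 1 (1 / 100) 3 := Real.sqrt_nonneg _
  have hρsq : rho0 1 (1 / 100) 3 ^ 2 = 1 / 800 := by
    rw [rho0_sq hlam hs]; norm_num
  have hnorm : ‖((rho0 1 (1 / 100) 3 : ℝ) : ℂ)‖ = rho0 1 (1 / 100) 3 := by
    rw [Complex.norm_real, Real.norm_eq_abs, abs_of_nonneg hρ0]
  have hΛ : lamK 1 (1 / 100) 3 = 1 / 100 := by norm_num [lamK]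
  refine ⟨?_, ?_⟩
  · unfold chiX
    rw [if_pos (by norm_num), hnorm, hΛ, mul_one]
    refine cutoff_eq_zero χ (by norm_num) ?_
    rw [abs_of_nonneg hρ0]
    -- 1/100 ≤ ρ₀ since ρ₀² = 1/800 ≥ (1/100)²
    nlinarith [hρsq, hρ0]
  · rw [Pk_apply_eq hlam hs 3, hnorm, sub_self]
    ring

end

end Literature.MathematicalPhysics.QuantumFieldTheory.BalabanImbrieJaffe1984to88.BIJ88Claim279PkLower
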